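import Summits.BirchSwinnertonDyer.BirchSwinnertonDyer.Theorems.BiquadraticEisensteinDescentHeegnerTwistCouplingInSupplyQuarticPartnerLadder
import Literature.NumberTheory.EllipticCurves.QuarticTwistEntireLFunction
import HarnessLib

set_option linter.dupNamespace false -- `Summit.BirchSwinnertonDyer.BirchSwinnertonDyer.Theorems.…` (summit = sub)
set_option autoImplicit false

/-!
# Crux `HeegnerTwistCouplingInSupply` (stmt-BirchSwinnertonDyer-21381) — the QUARTIC `j = 1728` corner `W_p⁻ : y² = x³ − p·x`:
# the partner ladder modulo Burungale–Tian ONLY (the Deuring–Hecke leaf removed)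

Route `BiquadraticEisensteinDescent` (cell `pub/bsd-wall`, width seat `bsd-wall-cm-bed-w4` g14; `--supports` 21381, helper). Bookkeeping upgrade
of bed-w4 g13's H⁻ corner theorems (`…QuarticTwistCorner.cruxOnQuarticCorner_of_two_facts`, `…QuarticPartnerCorner.cruxOnQuarticCornerPartner_of_two_facts`,
`…QuarticPartnerLadder.cruxOnQuarticCornerLadder_of_two_facts`), which are stated modulo TWO named facts — Burungale–Tian's rank-zero `2`-converse for
CM curves (`hBT`) and Deuring–Hecke (`hH : hasEntireLFunction_of_j_mem_maximalCMJInvariants`, used only to read `r_an = 0` as `L(1) ≠ 0`). The second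
is NOT needed: the continuation of `L(y² = x³ + A x, s)` for fourth-power-free `A` is the tree THEOREM `QuarticTwist.hasEntireLFunction` (Ireland–Rosen
18.6/18.7, bed-w3 g12; FYI of 2026-08-28T18:54Z). This file restates the ladder with `hH` DELETED, everything else BY NAME:

* §1 `L_one_ne_zero_partner_of_BT` — `r_an = 0 ∧ L(1) ≠ 0` for `y² = x³ − r²pq²·x` in the partner cell (`rank_sha_corank_partner` + `j = 1728` +
  `QuarticTwist.hasEntireLFunction`; `−r²pq²` is fourth-power-free);
* §2 ★★ `cruxOnQuarticCornerPartner_of_BT` — the generic partner rung (any `r ≡ 5 (mod 8)`, threshold `8⁸r⁵ ≤ (2.718·3.1415)⁸P³`, `p ∈ 𝔽_r^{×2} ∖ 𝔽_r^{×4}`),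
  modulo `hBT` ONLY;
* §3 ★★ `cruxOnQuarticCornerThirtyNine_of_BT` — partner `5` with `P = 13`: EVERY prime `p ≡ 39 (mod 40)` (supersedes `cruxOnQuarticCorner_of_two_facts`,
  one fact instead of two, no pin table), and ★★ `cruxOnQuarticCornerLadder_of_BT` — the six-partner union (`5, 13, 29, 37, 53, 61`, `p ≥ 795`, ≈ 82 %
  of `p ≡ 7 (mod 8)` asymptotically) with the SAME statement as `cruxOnQuarticCornerLadder_of_two_facts` minus `hH`.

With `…QuarticMinusTripleRows` (every prime `p ≡ 7 (mod 8)`, `23 ≤ p < 6000`) the H⁻ corner is now, modulo Burungale–Tian ONLY: all `p < 6000`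
except `7`, all `p ≡ 39 (mod 40)`, and the five further quartic classes above `795`. HONEST FRAMING: a typed sub-corner on ONE CM family (measure zero in
«all CM `W`»); the crux (residual C⁺) is untouched; BSD is not proved by any of this. THEOREMS ONLY. Supports stmt-BirchSwinnertonDyer-21381.
-/

noncomputable section

open scoped Classical NumberField

namespace Summit.BirchSwinnertonDyer.BirchSwinnertonDyer.Theorems.BiquadraticEisensteinDescentHeegnerTwistCouplingInSupplyQuarticMinusOneFact

open _root_.WeierstrassCurve Literature.NumberTheory.EllipticCurves
open Summit.BirchSwinnertonDyer.BirchSwinnertonDyer.Theorems.BiquadraticEisensteinDescentHeegnerTwistCouplingInSupplyQuarticTwistLocal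
open Summit.BirchSwinnertonDyer.BirchSwinnertonDyer.Theorems.BiquadraticEisensteinDescentHeegnerTwistCouplingInSupplyQuarticTwistCorner
  (quadraticTwist_W j_and_hasCM_lit lit_eq eq_two_or_eq_of_prime_dvd_conductorNorm_W)
open Summit.BirchSwinnertonDyer.BirchSwinnertonDyer.Theorems.BiquadraticEisensteinDescentHeegnerTwistCouplingInSupplyQuarticPartnerCorner
  (rank_sha_corank_partner isSquare_partner_mod_p classes_thirteen classes_twentyNine classes_thirtySeven intCast_natCast_zmod_eq_mod)
open Summit.BirchSwinnertonDyer.BirchSwinnertonDyer.Theorems.BiquadraticEisensteinDescentHeegnerTwistCouplingInSupplyQuarticPartnerLadder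
  (classes_fiftyThree classes_sixtyOne)
open Summit.BirchSwinnertonDyer.BirchSwinnertonDyer.Theorems.BiquadraticEisensteinDescentHeegnerTwistCouplingInSupplyPartnerLadder
  (exists_witnessField_of jacobiSym_neg_mul_eq_one classNumber_lt_of_lever)
open Summit.BirchSwinnertonDyer.BirchSwinnertonDyer.Theorems.BiquadraticEisensteinDescentHeegnerTwistCouplingInSupplyThreeSquaresPinDual
  (ternaryPinThreeMinus_of_mod_eight_eq_seven)

/-! ## §1 The twist `y² = x³ − r²pq²·x`: `L(1) ≠ 0` modulo Burungale–Tian only -/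

section Twist

variable {p q r : ℕ} [hp : Fact p.Prime] [hq : Fact q.Prime] [hr : Fact r.Prime]

omit hp hq hr in
/-- `b = −r²pq²` (`r, p, q` distinct primes) is free of fourth powers. [folklore] -/
theorem not_pow_four_dvd_partner (hP : p.Prime) (hQ : q.Prime) (hR : r.Prime) (hrp : r ≠ p) (hqp : q ≠ p) (hrq : r ≠ q)
    (t : ℕ) (ht : t.Prime) : ¬ (t : ℤ) ^ 4 ∣ -(r ^ 2 * p * q ^ 2 : ℤ) := by
  intro h
  have h' : t ^ 4 ∣ r ^ 2 * p ^ 1 * q ^ 2 := by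
    have := Int.natAbs_dvd_natAbs.mpr h
    simpa [Int.natAbs_mul, Int.natAbs_pow, Int.natAbs_neg] using this
  have hcop : ∀ {a b : ℕ} (m n : ℕ), a.Prime → b.Prime → a ≠ b → Nat.Coprime (a ^ m) (b ^ n) := fun m n ha hb hab =>
    Nat.Coprime.pow m n ((Nat.coprime_primes ha hb).mpr hab)
  by_cases htr : t = r
  · subst htr
    have h1 : t ^ 4 ∣ t ^ 2 := by
      rw [show t ^ 2 * p ^ 1 * q ^ 2 = t ^ 2 * (p ^ 1 * q ^ 2) by ring] at h'
      exact ((hcop 4 1 hR hP hrp).mul_right (hcop 4 2 hR hQ hrq)).dvd_of_dvd_mul_right h'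
    have := (Nat.pow_dvd_pow_iff_le_right hR.one_lt).mp h1
    omega
  by_cases htp : t = p
  · subst htp
    have h1 : t ^ 4 ∣ t ^ 1 := by
      rw [show r ^ 2 * t ^ 1 * q ^ 2 = t ^ 1 * (r ^ 2 * q ^ 2) by ring] at h'
      exact ((hcop 4 2 hP hR (Ne.symm hrp)).mul_right (hcop 4 2 hP hQ (Ne.symm hqp))).dvd_of_dvd_mul_right h'
    have := (Nat.pow_dvd_pow_iff_le_right hP.one_lt).mp h1
    omega
  by_cases htq : t = q
  · subst htq
    have h1 : t ^ 4 ∣ t ^ 2 := by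
      rw [show r ^ 2 * p ^ 1 * t ^ 2 = t ^ 2 * (r ^ 2 * p ^ 1) by ring] at h'
      exact ((hcop 4 2 hQ hR (Ne.symm hrq)).mul_right (hcop 4 1 hQ hP hqp)).dvd_of_dvd_mul_right h'
    have := (Nat.pow_dvd_pow_iff_le_right hQ.one_lt).mp h1
    omega
  · have hc : Nat.Coprime (t ^ 4) (r ^ 2 * p ^ 1 * q ^ 2) :=
      ((hcop 4 2 ht hR htr).mul_right (hcop 4 1 ht hP htp)).mul_right (hcop 4 2 ht hQ htq)
    have h1 : t ^ 4 ∣ 1 := hc.dvd_of_dvd_mul_right (by simpa using h')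
    have := Nat.le_of_dvd one_pos h1
    have := Nat.one_lt_pow (n := 4) (by norm_num) ht.one_lt
    omega

/-- ★ **`L`-form, ONE named fact**: `r_an(E) = 0` and `L(E, 1) ≠ 0` for `E : y² = x³ − r²pq²·x` under the partner hypotheses (`p ≡ 7`, `q ≡ 3`,
`r ≡ 5 (mod 8)`, `(q/p) = −1`, `(r/p) = +1`, `p ∉ 𝔽_r^{×4}`), modulo Burungale–Tian ONLY — `…QuarticPartnerCorner.L_one_ne_zero_partner` with the
Deuring–Hecke hypothesis replaced by the tree theorem `QuarticTwist.hasEntireLFunction`. [cite: BurungaleTian2026, Thm. 1.1]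
[cite: IrelandRosen1990, Ch. 18 §6 Theorem 7] -/
theorem L_one_ne_zero_partner_of_BT (hBT : burungaleTian_analyticRank_eq_zero_of_selmerCorank_eq_zero_of_hasCM)
    (hp8 : p % 8 = 7) (hq8 : q % 8 = 3) (hr8 : r % 8 = 5)
    (hnq : ¬ IsSquare ((q : ℤ) : ZMod p)) (hsr : IsSquare ((r : ℤ) : ZMod p)) (hp4 : ∀ t : ZMod r, t ^ 4 ≠ ((p : ℤ) : ZMod r))
    [hE : (⟨0, ((0 : ℤ) : ℚ), 0, ((-(r ^ 2 * p * q ^ 2) : ℤ) : ℚ), 0⟩ : WeierstrassCurve ℚ).IsElliptic] :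
    (⟨0, ((0 : ℤ) : ℚ), 0, ((-(r ^ 2 * p * q ^ 2) : ℤ) : ℚ), 0⟩ : WeierstrassCurve ℚ).analyticRank = 0 ∧
    (⟨0, ((0 : ℤ) : ℚ), 0, ((-(r ^ 2 * p * q ^ 2) : ℤ) : ℚ), 0⟩ : WeierstrassCurve ℚ).entireLFunction 1 ≠ 0 := by
  haveI : Fact (Nat.Prime 2) := ⟨Nat.prime_two⟩
  have hP := hp.out
  have hQ := hq.out
  have hR := hr.out
  have hrp : r ≠ p := by rintro rfl; omega
  have hb : (-(r ^ 2 * p * q ^ 2) : ℤ) ≠ 0 :=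
    neg_ne_zero.mpr (mul_ne_zero (mul_ne_zero (pow_ne_zero 2 (by exact_mod_cast hR.ne_zero))
      (by exact_mod_cast hP.ne_zero)) (pow_ne_zero 2 (by exact_mod_cast hQ.ne_zero)))
  obtain ⟨-, hCM⟩ := j_and_hasCM_lit hb
  obtain ⟨-, -, hcor⟩ := rank_sha_corank_partner hp8 hq8 hr8 hnq hsr hp4
  have h0 := hBT _ hCM 2 hcor
  have h4 := not_pow_four_dvd_partner hP hQ hR hrp (by rintro rfl; omega) (by rintro rfl; omega)
  have hH := QuarticTwist.hasEntireLFunction hb h4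
  rw [← lit_eq] at hH
  exact ⟨h0, (analyticRank_eq_zero_iff_holds
    (W := (⟨0, ((0 : ℤ) : ℚ), 0, ((-(r ^ 2 * p * q ^ 2) : ℤ) : ℚ), 0⟩ : WeierstrassCurve ℚ)) hH).1 h0⟩

end Twist

/-! ## §2 ★★ The generic partner rung, modulo Burungale–Tian only -/

section Rung

/-- ★★ **THE GENERIC PARTNER RUNG for `W_p⁻ : y² = x³ − px`, ONE NAMED FACT.** For a partner prime `r ≡ 5 (mod 8)` and a threshold `P`
with `8⁸r⁵ ≤ (2.718·3.1415)⁸P³`: for every prime `p ≡ 7 (mod 8)`, `p ≥ P`, with `p` a square but not a fourth power modulo `r`, there is a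
Heegner field `K′ = ℚ(√−qr)` of `N(W_p⁻)` (`q < p` the three-squares pin, `q ≡ 3 (8)`, `(q/p) = −1`) with `4 < |d_{K′}|`, `L(W_p⁻^{(d_{K′})}, 1) ≠ 0`,
`h(K′) < p` and `p ∤ h(K′)` — `…QuarticPartnerCorner.cruxOnQuarticCornerPartner_of_two_facts` with `hH` DELETED. [cite: BurungaleTian2026, Thm. 1.1]
[cite: SilvermanAEC2009, Prop. X.4.9, Prop. X.4.7, Thm. X.4.2(a)] [cite: Oesterle1988Gauss, II §3 Proposition p. 57 (27)] -/
theorem cruxOnQuarticCornerPartner_of_BT (hBT : burungaleTian_analyticRank_eq_zero_of_selmerCorank_eq_zero_of_hasCM)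
    {r : ℕ} (hr : r.Prime) (hr8 : r % 8 = 5) {P : ℕ} (hkey : (8 : ℝ) ^ 8 * ((r : ℕ) : ℝ) ^ 5 ≤ (2.718 * 3.1415) ^ 8 * (P : ℝ) ^ 3) :
    ∀ (p : ℕ) [Fact p.Prime] [(⟨0, 0, 0, -(p : ℚ), 0⟩ : WeierstrassCurve ℚ).IsElliptic]
      [(⟨0, 0, 0, -(p : ℚ), 0⟩ : WeierstrassCurve ℚ).IsGloballyMinimal]
      [NeZero ((⟨0, 0, 0, -(p : ℚ), 0⟩ : WeierstrassCurve ℚ).conductorNorm ℤ)],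
      p % 8 = 7 → P ≤ p → IsSquare ((p : ℤ) : ZMod r) → (∀ t : ZMod r, t ^ 4 ≠ ((p : ℤ) : ZMod r)) →
      ∃ (K : Type) (_ : Field K) (_ : NumberField K),
        IsImaginaryQuadratic K ∧ 4 < (NumberField.discr K).natAbs ∧
        SatisfiesHeegnerHypothesis ((⟨0, 0, 0, -(p : ℚ), 0⟩ : WeierstrassCurve ℚ).conductorNorm ℤ) K ∧
        ((⟨0, 0, 0, -(p : ℚ), 0⟩ : WeierstrassCurve ℚ).quadraticTwist (NumberField.discr K : ℚ)).entireLFunction 1 ≠ 0 ∧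
        NumberField.classNumber K < p ∧ ¬ p ∣ NumberField.classNumber K := by
  intro p hpF _ _ _ hp8 hPp hsq hp4
  have hp : p.Prime := hpF.out
  haveI : Fact r.Prime := ⟨hr⟩
  have hrp : r ≠ p := by
    rintro rfl
    exact hp4 0 (by rw [zero_pow four_ne_zero]; push_cast; rw [ZMod.natCast_self])
  have hsr : IsSquare ((r : ℤ) : ZMod p) := isSquare_partner_mod_p (by omega) (by rintro rfl; omega) hrp hsq
  obtain ⟨q, hq, hqlt, hq8, hJq⟩ := ternaryPinThreeMinus_of_mod_eight_eq_seven p hp hp8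
  haveI : Fact q.Prime := ⟨hq⟩
  have hnq : ¬ IsSquare ((q : ℤ) : ZMod p) := by
    rw [← legendreSym.eq_neg_one_iff p, jacobiSym.legendreSym.to_jacobiSym]; exact hJq
  have hr0 : ((r : ℤ) : ZMod p) ≠ 0 := by
    intro h0
    have : (p : ℤ) ∣ r := (ZMod.intCast_zmod_eq_zero_iff_dvd r p).mp h0
    have : p ∣ r := by exact_mod_cast this
    exact hrp ((Nat.prime_dvd_prime_iff_eq hp hr).mp this).symm
  have hJr : jacobiSym (r : ℤ) p = 1 := by
    rw [← jacobiSym.legendreSym.to_jacobiSym, legendreSym.eq_one_iff p hr0]; exact hsr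
  have hJ : jacobiSym (-((q * r : ℕ) : ℤ)) p = 1 := by
    rw [Nat.mul_comm]; exact jacobiSym_neg_mul_eq_one (by omega) hJr hJq
  have hxc : ((q * r : ℕ) : ℝ) < ((r : ℕ) : ℝ) * p := by
    have h1 : q * r < r * p := by have := hr.pos; nlinarith
    exact_mod_cast h1
  have hh := classNumber_lt_of_lever hq hr hr8 hxc hkey hPp
  obtain ⟨K, iF, iN, hK, hdK, hH', hcl⟩ := exists_witnessField_of
    (N := (⟨0, 0, 0, -(p : ℚ), 0⟩ : WeierstrassCurve ℚ).conductorNorm ℤ) hq hq8 hr hr8 hJ hh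
    (fun s hs hsN => eq_two_or_eq_of_prime_dvd_conductorNorm_W hp hs hsN)
  refine ⟨K, iF, iN, hK, ?_, hH', ?_, hcl, fun hdvd =>
    absurd (Nat.le_of_dvd (NumberField.classNumber_pos K) hdvd) (not_le.mpr hcl)⟩
  · rw [hdK, Int.natAbs_neg, Int.natAbs_natCast]
    have := hq.two_le
    have : 5 ≤ r := by have := hr.two_le; omega
    nlinarith
  · rw [hdK, quadraticTwist_W]
    rw [show (-((-((q * r : ℕ) : ℤ)) ^ 2 * p) : ℤ) = (-(r ^ 2 * p * q ^ 2) : ℤ) by push_cast; ring]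
    have hb : (-(r ^ 2 * p * q ^ 2) : ℤ) ≠ 0 :=
      neg_ne_zero.mpr (mul_ne_zero (mul_ne_zero (pow_ne_zero 2 (by exact_mod_cast hr.ne_zero))
        (by exact_mod_cast hp.ne_zero)) (pow_ne_zero 2 (by exact_mod_cast hq.ne_zero)))
    have hab : (-(r ^ 2 * p * q ^ 2) : ℤ) * ((0 : ℤ) ^ 2 - 4 * (-(r ^ 2 * p * q ^ 2) : ℤ)) ≠ 0 := by
      refine mul_ne_zero hb ?_
      rw [show ((0 : ℤ) ^ 2 - 4 * (-(r ^ 2 * p * q ^ 2) : ℤ)) = 4 * (r ^ 2 * p * q ^ 2) by ring]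
      exact mul_ne_zero (by norm_num) (neg_ne_zero.mp hb)
    haveI := isElliptic_mk_of_ne_zero (F := ℚ) hab
    exact (L_one_ne_zero_partner_of_BT hBT hp8 hq8 hr8 hnq hsr hp4).2

end Rung

/-! ## §3 ★★ Partner `5` for every `p ≡ 39 (mod 40)` and the six-partner ladder, modulo Burungale–Tian only -/

section Ladder

/-- The squares that are not fourth powers modulo `5`: `4`. [folklore] -/
theorem classes_five : ∀ a : ZMod 5, a = 4 → IsSquare a ∧ ∀ t : ZMod 5, t ^ 4 ≠ a := by decide

/-- ★★ **PARTNER `5`: EVERY prime `p ≡ 39 (mod 40)`** (`p ≡ 7 (mod 8)`, `p ≡ 4 (mod 5)`), modulo Burungale–Tian ONLY — the generic rung with `r = 5`,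
`P = 13` (`8⁸·5⁵ ≤ (2.718·3.1415)⁸·13³`; `p ≥ 39`). Supersedes `…QuarticTwistCorner.cruxOnQuarticCorner_of_two_facts` (same primes, two facts).
[cite: BurungaleTian2026, Thm. 1.1] [cite: Oesterle1988Gauss, II §3 Proposition p. 57 (27)] -/
theorem cruxOnQuarticCornerThirtyNine_of_BT (hBT : burungaleTian_analyticRank_eq_zero_of_selmerCorank_eq_zero_of_hasCM) :
    ∀ (p : ℕ) [Fact p.Prime] [(⟨0, 0, 0, -(p : ℚ), 0⟩ : WeierstrassCurve ℚ).IsElliptic]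
      [(⟨0, 0, 0, -(p : ℚ), 0⟩ : WeierstrassCurve ℚ).IsGloballyMinimal]
      [NeZero ((⟨0, 0, 0, -(p : ℚ), 0⟩ : WeierstrassCurve ℚ).conductorNorm ℤ)],
      p % 8 = 7 → p % 5 = 4 →
      ∃ (K : Type) (_ : Field K) (_ : NumberField K),
        IsImaginaryQuadratic K ∧ 4 < (NumberField.discr K).natAbs ∧
        SatisfiesHeegnerHypothesis ((⟨0, 0, 0, -(p : ℚ), 0⟩ : WeierstrassCurve ℚ).conductorNorm ℤ) K ∧
        ((⟨0, 0, 0, -(p : ℚ), 0⟩ : WeierstrassCurve ℚ).quadraticTwist (NumberField.discr K : ℚ)).entireLFunction 1 ≠ 0 ∧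
        NumberField.classNumber K < p ∧ ¬ p ∣ NumberField.classNumber K := by
  intro p _ _ _ _ hp8 hp5
  have hcast : ((p : ℤ) : ZMod 5) = ((p % 5 : ℕ) : ZMod 5) := intCast_natCast_zmod_eq_mod p 5
  have hcl : ((p : ℤ) : ZMod 5) = 4 := by rw [hcast, hp5]; rfl
  obtain ⟨hsq, hp4⟩ := classes_five _ hcl
  exact cruxOnQuarticCornerPartner_of_BT hBT (by norm_num) (by norm_num) (P := 13) (by norm_num) p hp8 (by omega) hsq hp4

/-- ★★ **THE QUARTIC PARTNER LADDER, six partners, ONE NAMED FACT**: for every prime `p ≡ 7 (mod 8)`, `p ≥ 795`, in a sharp class modulo one of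
`5, 13, 29, 37, 53, 61`, the CONCLUSION of crux 21381 holds for `W_p⁻ : y² = x³ − p·x` — the statement of `…QuarticPartnerLadder.cruxOnQuarticCornerLadder_of_two_facts`
with `hH` DELETED (class lemmas `classes_thirteen`, …, `classes_sixtyOne` BY NAME). [cite: BurungaleTian2026, Thm. 1.1]
[cite: SilvermanAEC2009, Prop. X.4.9, Prop. X.4.7, Thm. X.4.2(a)] [cite: Oesterle1988Gauss, II §3 Proposition p. 57 (27)] -/
theorem cruxOnQuarticCornerLadder_of_BT (hBT : burungaleTian_analyticRank_eq_zero_of_selmerCorank_eq_zero_of_hasCM) :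
    ∀ (p : ℕ) [Fact p.Prime] [(⟨0, 0, 0, -(p : ℚ), 0⟩ : WeierstrassCurve ℚ).IsElliptic]
      [(⟨0, 0, 0, -(p : ℚ), 0⟩ : WeierstrassCurve ℚ).IsGloballyMinimal]
      [NeZero ((⟨0, 0, 0, -(p : ℚ), 0⟩ : WeierstrassCurve ℚ).conductorNorm ℤ)],
      p % 8 = 7 → 795 ≤ p →
      (p % 5 = 4 ∨ (p % 13 = 4 ∨ p % 13 = 10 ∨ p % 13 = 12) ∨ (p % 29 = 4 ∨ p % 29 = 5 ∨ p % 29 = 6 ∨ p % 29 = 9 ∨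
          p % 29 = 13 ∨ p % 29 = 22 ∨ p % 29 = 28) ∨
        (p % 37 = 3 ∨ p % 37 = 4 ∨ p % 37 = 11 ∨ p % 37 = 21 ∨ p % 37 = 25 ∨ p % 37 = 27 ∨ p % 37 = 28 ∨ p % 37 = 30 ∨
            p % 37 = 36) ∨
        (p % 53 = 4 ∨ p % 53 = 6 ∨ p % 53 = 7 ∨ p % 53 = 9 ∨ p % 53 = 11 ∨ p % 53 = 17 ∨ p % 53 = 25 ∨ p % 53 = 29 ∨
            p % 53 = 37 ∨ p % 53 = 38 ∨ p % 53 = 40 ∨ p % 53 = 43 ∨ p % 53 = 52) ∨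
        (p % 61 = 3 ∨ p % 61 = 4 ∨ p % 61 = 5 ∨ p % 61 = 14 ∨ p % 61 = 19 ∨ p % 61 = 27 ∨ p % 61 = 36 ∨ p % 61 = 39 ∨
            p % 61 = 41 ∨ p % 61 = 45 ∨ p % 61 = 46 ∨ p % 61 = 48 ∨ p % 61 = 49 ∨ p % 61 = 52 ∨ p % 61 = 60)) →
      ∃ (K : Type) (_ : Field K) (_ : NumberField K),
        IsImaginaryQuadratic K ∧ 4 < (NumberField.discr K).natAbs ∧
        SatisfiesHeegnerHypothesis ((⟨0, 0, 0, -(p : ℚ), 0⟩ : WeierstrassCurve ℚ).conductorNorm ℤ) K ∧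
        ((⟨0, 0, 0, -(p : ℚ), 0⟩ : WeierstrassCurve ℚ).quadraticTwist (NumberField.discr K : ℚ)).entireLFunction 1 ≠ 0 ∧
        NumberField.classNumber K < p ∧ ¬ p ∣ NumberField.classNumber K := by
  intro p _ _ _ _ hp8 hP h
  rcases h with h5 | h13 | h29 | h37 | h53 | h61
  · exact cruxOnQuarticCornerThirtyNine_of_BT hBT p hp8 h5
  · have hcl : ((p : ℤ) : ZMod 13) = 4 ∨ ((p : ℤ) : ZMod 13) = 10 ∨ ((p : ℤ) : ZMod 13) = 12 := by
      rw [intCast_natCast_zmod_eq_mod p 13]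
      rcases h13 with h | h | h <;> rw [h] <;> simp
    obtain ⟨hsq, hp4⟩ := classes_thirteen _ hcl
    exact cruxOnQuarticCornerPartner_of_BT hBT (by norm_num) (by norm_num) (P := 61) (by norm_num) p hp8 (by omega) hsq hp4
  · have hcl : ((p : ℤ) : ZMod 29) = 4 ∨ ((p : ℤ) : ZMod 29) = 5 ∨ ((p : ℤ) : ZMod 29) = 6 ∨ ((p : ℤ) : ZMod 29) = 9 ∨
        ((p : ℤ) : ZMod 29) = 13 ∨ ((p : ℤ) : ZMod 29) = 22 ∨ ((p : ℤ) : ZMod 29) = 28 := by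
      rw [intCast_natCast_zmod_eq_mod p 29]
      rcases h29 with h | h | h | h | h | h | h <;> rw [h] <;> simp
    obtain ⟨hsq, hp4⟩ := classes_twentyNine _ hcl
    exact cruxOnQuarticCornerPartner_of_BT hBT (by norm_num) (by norm_num) (P := 231) (by norm_num) p hp8 (by omega) hsq hp4
  · have hcl : ((p : ℤ) : ZMod 37) = 3 ∨ ((p : ℤ) : ZMod 37) = 4 ∨ ((p : ℤ) : ZMod 37) = 11 ∨ ((p : ℤ) : ZMod 37) = 21 ∨
        ((p : ℤ) : ZMod 37) = 25 ∨ ((p : ℤ) : ZMod 37) = 27 ∨ ((p : ℤ) : ZMod 37) = 28 ∨ ((p : ℤ) : ZMod 37) = 30 ∨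
        ((p : ℤ) : ZMod 37) = 36 := by
      rw [intCast_natCast_zmod_eq_mod p 37]
      rcases h37 with h | h | h | h | h | h | h | h | h <;> rw [h] <;> simp
    obtain ⟨hsq, hp4⟩ := classes_thirtySeven _ hcl
    exact cruxOnQuarticCornerPartner_of_BT hBT (by norm_num) (by norm_num) (P := 346) (by norm_num) p hp8 (by omega) hsq hp4
  · have hcl : ((p : ℤ) : ZMod 53) = 4 ∨ ((p : ℤ) : ZMod 53) = 6 ∨ ((p : ℤ) : ZMod 53) = 7 ∨ ((p : ℤ) : ZMod 53) = 9 ∨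
        ((p : ℤ) : ZMod 53) = 11 ∨ ((p : ℤ) : ZMod 53) = 17 ∨ ((p : ℤ) : ZMod 53) = 25 ∨ ((p : ℤ) : ZMod 53) = 29 ∨
        ((p : ℤ) : ZMod 53) = 37 ∨ ((p : ℤ) : ZMod 53) = 38 ∨ ((p : ℤ) : ZMod 53) = 40 ∨ ((p : ℤ) : ZMod 53) = 43 ∨
        ((p : ℤ) : ZMod 53) = 52 := by
      rw [intCast_natCast_zmod_eq_mod p 53]
      rcases h53 with h | h | h | h | h | h | h | h | h | h | h | h | h <;> rw [h] <;> simp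
    obtain ⟨hsq, hp4⟩ := classes_fiftyThree _ hcl
    exact cruxOnQuarticCornerPartner_of_BT hBT (by norm_num) (by norm_num) (P := 629) (by norm_num) p hp8 (by omega) hsq hp4
  · have hcl : ((p : ℤ) : ZMod 61) = 3 ∨ ((p : ℤ) : ZMod 61) = 4 ∨ ((p : ℤ) : ZMod 61) = 5 ∨ ((p : ℤ) : ZMod 61) = 14 ∨
        ((p : ℤ) : ZMod 61) = 19 ∨ ((p : ℤ) : ZMod 61) = 27 ∨ ((p : ℤ) : ZMod 61) = 36 ∨ ((p : ℤ) : ZMod 61) = 39 ∨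
        ((p : ℤ) : ZMod 61) = 41 ∨ ((p : ℤ) : ZMod 61) = 45 ∨ ((p : ℤ) : ZMod 61) = 46 ∨ ((p : ℤ) : ZMod 61) = 48 ∨
        ((p : ℤ) : ZMod 61) = 49 ∨ ((p : ℤ) : ZMod 61) = 52 ∨ ((p : ℤ) : ZMod 61) = 60 := by
      rw [intCast_natCast_zmod_eq_mod p 61]
      rcases h61 with h | h | h | h | h | h | h | h | h | h | h | h | h | h | h <;> rw [h] <;> simp
    obtain ⟨hsq, hp4⟩ := classes_sixtyOne _ hcl
    exact cruxOnQuarticCornerPartner_of_BT hBT (by norm_num) (by norm_num) (P := 795) (by norm_num) p hp8 hP hsq hp4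

end Ladder

end Summit.BirchSwinnertonDyer.BirchSwinnertonDyer.Theorems.BiquadraticEisensteinDescentHeegnerTwistCouplingInSupplyQuarticMinusOneFact

end
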